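import Summits.Ventures.PercRepro.SixFourTransfer
import Summits.Ventures.PercRepro.SixFourResidueOnly

/-!
# PercRepro — C-025 at `(6,4)`: the per-solid residue as THREE CLAUSES (p3, gen 10; mine-2's §21.17 / §21.18.5)

`SixFourResidue` (`SixFourTransfer.lean`) — the hypothesis left in `rls_six_four_of_residue` — asks, on every solid
of every simple core matroid, for `0 ≤ J₃` at type `3` off the cell `Cell10` and for `0 ≤ J₄` at type `4` when
`g ≤ 9` or some plane trace has `≥ 8` points.  This file names its three proof obligations as ordinary `Prop`s in the
plain vocabulary (no `typeOf`, no core hypotheses):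
* `TypeThreeClause` — the type-`3` clause verbatim (mine-2's Theorem 21′ for `g ≥ 10` and the `g ≤ 9` census);
* `SmallClause` — `0 ≤ J₄(G)` for every rank-`4` `G ⊆ E` with `g ≤ 9` (p2's `J_four_nonneg_of_card_le_nine`);
* `BigPlaneClause` — `0 ≤ J₄(G)` for every rank-`4` `G ⊆ E` with `g ≥ 10` and a plane trace of `≥ 8` points (the
  content of mine-2's THEOREM 22′, §21.17, beyond Theorem 22: `twentyTwoPrime_iff_bigPlane`);
and proves **`sixFourResidue_of_clauses : TypeThreeClause → SmallClause → BigPlaneClause → SixFourResidue`**, hence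
**`rls_six_four_of_clauses`**: C-025 at `(6,4)` on every finite matroid from the three clauses.
-/

namespace PercRepro.SixFour

open Finset ThmH PerFlat ThmN

/-- **The type-`3` clause of `SixFourResidue`**: on every solid `G` of a simple core matroid (rank `≥ 6`,
coloop-free at rank `6`), `typeOf M G = 3` and `¬ Cell10 M G` give `0 ≤ J₃(G)`. -/
def TypeThreeClause : Prop :=
  ∀ {β : Type} [DecidableEq β] (M : Matroid β) [M.Finite] (G : Finset β), Simple M → (6 : ℕ∞) ≤ M.eRank →
    (M.eRank = 6 → ∀ e, ¬ M.IsColoop e) → G ∈ flatsQ M 4 → typeOf M G = 3 → ¬ Cell10 M G → 0 ≤ J M G 3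

/-- **The small clause**: `0 ≤ J₄(G)` for every rank-`4` set `G ⊆ E` of a simple matroid with at most `9` points. -/
def SmallClause : Prop :=
  ∀ {β : Type} [DecidableEq β] (M : Matroid β) [M.Finite] (G : Finset β), Simple M → G ⊆ gr M →
    M.eRk (G : Set β) = 4 → G.card ≤ 9 → 0 ≤ J M G 4

/-- **The big-plane clause** (Theorem 22′ beyond Theorem 22): `0 ≤ J₄(G)` for every rank-`4` set `G ⊆ E` of a
simple matroid with at least `10` points and a plane trace of at least `8` points. -/
def BigPlaneClause : Prop :=
  ∀ {β : Type} [DecidableEq β] (M : Matroid β) [M.Finite] (G : Finset β), Simple M → G ⊆ gr M →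
    M.eRk (G : Set β) = 4 → 10 ≤ G.card → (∃ P ∈ planes M, 8 ≤ (P ∩ G).card) → 0 ≤ J M G 4

/-- **Theorem 22′ (§21.17, no plane cap)** as a `Prop`: `0 ≤ J₄(G)` for every rank-`4` set `G ⊆ E` of a simple
matroid with at least `10` points. -/
def TwentyTwoPrime : Prop :=
  ∀ {β : Type} [DecidableEq β] (M : Matroid β) [M.Finite] (G : Finset β), Simple M → G ⊆ gr M →
    M.eRk (G : Set β) = 4 → 10 ≤ G.card → 0 ≤ J M G 4

/-- Theorem 22′ is exactly Theorem 22 (`J_four_nonneg_of_ten_le`, in the tree) plus the big-plane clause. -/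
theorem twentyTwoPrime_iff_bigPlane : TwentyTwoPrime ↔ BigPlaneClause := by
  constructor
  · intro h β _ M _ G hs hG hr hg _
    exact h M G hs hG hr hg
  · intro h β _ M _ G hs hG hr hg
    by_cases hbig : ∃ P ∈ planes M, 8 ≤ (P ∩ G).card
    · exact h M G hs hG hr hg hbig
    · push Not at hbig
      exact J_four_nonneg_of_ten_le hs hG hr (fun P hP => by have := hbig P hP; omega) hg

/-- **`SixFourResidue` from its three clauses.** -/
theorem sixFourResidue_of_clauses (h3 : TypeThreeClause) (h4s : SmallClause) (h4b : BigPlaneClause) :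
    SixFourResidue := by
  intro β _ M _ G hs hge hcol hG
  have hGg : G ⊆ gr M := (mem_flatsQ.1 hG).1
  have hr : M.eRk (G : Set β) = 4 := (mem_flatsQ.1 hG).2.2
  refine ⟨fun ht hc => h3 M G hs hge hcol hG ht hc, fun _ hsmall => ?_⟩
  rcases hsmall with hg9 | hbig
  · exact h4s M G hs hGg hr hg9
  · by_cases hg : 10 ≤ G.card
    · exact h4b M G hs hGg hr hg hbig
    · exact h4s M G hs hGg hr (by omega)

/-- **C-025 at `(6, 4)` on every finite matroid from the three clauses**: `RLS M 6 4`. -/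
theorem rls_six_four_of_clauses {α : Type} (h3 : TypeThreeClause) (h4s : SmallClause) (h4b : BigPlaneClause)
    (M : Matroid α) [M.Finite] : RLS M 6 4 :=
  rls_six_four_of_residue (sixFourResidue_of_clauses h3 h4s h4b) M

end PercRepro.SixFour
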